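import Mathlib
import Literature.MathematicalPhysics.QuantumFieldTheory.BalabanImbrieJaffe1984to88.BIJ85Eq715ConfigSymbols
import Literature.MathematicalPhysics.QuantumFieldTheory.BalabanImbrieJaffe1984to88.BIJ85Eq712SymbolCalculus
import Literature.MathematicalPhysics.QuantumFieldTheory.BalabanImbrieJaffe1984to88.BIJ85Eq7122Loewner

/-!
# `BalabanImbrieJaffe1984to88.BIJ85Eq716ConfigLaplacian` — T. Bałaban, J. Imbrie, A. Jaffe, *Renormalization of the Higgs model:
minimizers, propagators and the stability of mean field theory*, Commun. Math. Phys. **97** (1985) 299–329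
[BalabanImbrieJaffe1985]: Sect. 7.1 p. 322 — **(7.1.6) `Δ^{(1)}(p) = Tr ∂^{(1)}(p)^*∂^{(1)}(p)` FROM CONFIGURATION SPACE**: the
unit-lattice Laplacian `Δ^{(1)} = Σ_ν (∂^{(1)}_ν)^*∂^{(1)}_ν` on multi-component fields over the unit torus is translation
invariant with symbol `Δ^{(1)}(p)·1 = Σ_ν |e^{ip_ν} − 1|²·1` (r15's `BIJ85MomentumSymbols71.lapOne` at the reduced momentum
`sOf`), its momentum representation, and `0 ≤ Δ^{(1)}` — file 8 of the (7.1.2) cluster (`BIJ85Eq712Plancherel`,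
`BIJ85Eq712SymbolCalculus`, `BIJ85Eq715ConfigSymbols`, `BIJ85Eq7122Loewner`)

statement-level skeleton of published theorems with citation tags; proofs where landed; nothing here is a claim about
the Yang–Mills mass gap

PDF held: `paper:balaban1985-cmp97-bij-higgs-minimizers` (journal page = PDF page + 298).  Text read: PDF p. 24 (journal 322).

CITATION HEADER (lean-in-tree rule).  Part of the lit-balaban TYPED SKELETON (HOME `run/shared/lean/pub/lit-balaban/`); WHAT IS
REPRODUCED: the unit-lattice member of display **(7.1.6)** of SKELETON row **C1.Eq7.1.2-7.1.12** (p. 322 [PDF 24], verbatim: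
*"The corresponding Laplacians are Δ(p) = Tr ∂(p)^*∂(p), Δ^{(1)}(p) = Tr ∂^{(1)}(p)^*∂^{(1)}(p). (7.1.6)"*; typed by r15 as the
real numbers `lapSym η p = Σ_μ |∂_μ(p)|²`, `lapOne p = Σ_μ |∂^{(1)}_μ(p)|²` with `trace_dMat`, `lapOne_eq`), `HOME/lit-balaban-r15/ROWS-C1.md`
(owner r15, referee ref-5).  TYPED READING: as in `BIJ85Eq715ConfigSymbols` — unit torus `Tor N`, fields `Tor N × m → ℂ`,
`F⊗1 = dftC`, forward differences `fdiffC N m ν = S_ν − 1`, symbols `symb`; the unit-lattice Laplacian in configuration space is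
the operator `Σ_ν (∂^{(1)}_ν)^*∂^{(1)}_ν = Σ_ν (fdiffC ν)ᴴ(fdiffC ν)` (no new definition is introduced: the theorems are stated
for this expression).  WHAT IS KERNEL-CHECKED (zero `sorry`, standard axioms): `isTranslInv_sum` / `symb_sum` (symbol
calculus for finite sums), `isTranslInv_fdiffC_conjTranspose_mul`, **`symb_fdiffC_conjTranspose_mul`** (`symb (∂_ν^*∂_ν) q =
|∂^{(1)}_ν(p)|²·1`, `p = sOf N q`), `isTranslInv_laplaceOne`, **`symb_laplaceOne`** (`symb Δ^{(1)} q = Δ^{(1)}(p)·1 = lapOne (sOf N q)·1`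
— (7.1.6) PROVED as the momentum representation of the configuration-space Laplacian), `dftC_laplaceOne_mulVec`
(`(F⊗1)(Δ^{(1)}f)(q,i) = Δ^{(1)}(p) f̂_i(q)`), `symb_laplaceOne_eq_cos` (`= Σ_μ(2 − 2cos p_μ)·1`, r15's `lapOne_eq`),
`posSemidef_laplaceOne` (`0 ≤ Δ^{(1)}`).  NOT CLAIMED: the η-lattice member Δ(p) (fine torus; its symbol `∂_ν(p′+l)` is
`Balaban1983to89.B5Prop11Plancherel.fsym_emb`).  Unit `lit-balaban-p27` (gen 4).
-/

namespace Literature.MathematicalPhysics.QuantumFieldTheory.BalabanImbrieJaffe1984to88.BIJ85Eq716ConfigLaplacian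

open scoped BigOperators Matrix ComplexConjugate ComplexOrder
open Finset Complex
open Literature.MathematicalPhysics.QuantumFieldTheory.Balaban1983to89.B5Prop11Plancherel
open Literature.MathematicalPhysics.QuantumFieldTheory.BalabanImbrieJaffe1984to88.BIJ85Eq712Plancherel
open Literature.MathematicalPhysics.QuantumFieldTheory.BalabanImbrieJaffe1984to88.BIJ85Eq712SymbolCalculus
open Literature.MathematicalPhysics.QuantumFieldTheory.BalabanImbrieJaffe1984to88.BIJ85Eq715ConfigSymbols
open Literature.MathematicalPhysics.QuantumFieldTheory.BalabanImbrieJaffe1984to88.BIJ85Eq7122Loewner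
open Literature.MathematicalPhysics.QuantumFieldTheory.BalabanImbrieJaffe1984to88.BIJ85MomentumSymbols71

noncomputable section

variable {d : ℕ} (N : Fin d → ℕ) [hN : ∀ μ, NeZero (N μ)] (m : Type*) [Fintype m] [DecidableEq m]

/-! ## §1 Symbol calculus for finite sums -/

omit hN [Fintype m] [DecidableEq m] in
/-- a finite sum of translation-invariant operators is translation invariant. [cite: BalabanImbrieJaffe1985, (7.1.6) p.322] -/
theorem isTranslInv_sum {ι : Type*} (s : Finset ι) {T : ι → Matrix (Tor N × m) (Tor N × m) ℂ}
    (hT : ∀ ν ∈ s, IsTranslInv N m (T ν)) : IsTranslInv N m (∑ ν ∈ s, T ν) := by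
  intro a x y i j
  rw [Matrix.sum_apply, Matrix.sum_apply]
  exact Finset.sum_congr rfl fun ν hν => hT ν hν a x y i j

omit [Fintype m] [DecidableEq m] in
/-- the symbol of a finite sum is the sum of the symbols. [cite: BalabanImbrieJaffe1985, (7.1.6) p.322] -/
theorem symb_sum {ι : Type*} (s : Finset ι) (T : ι → Matrix (Tor N × m) (Tor N × m) ℂ) (q : Tor N) :
    symb N m (∑ ν ∈ s, T ν) q = ∑ ν ∈ s, symb N m (T ν) q := by
  classical
  induction s using Finset.induction_on with
  | empty => rw [Finset.sum_empty, Finset.sum_empty, ← symbR_eq_symb, symbR_zero]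
  | insert ν s hν ih => rw [Finset.sum_insert hν, Finset.sum_insert hν, ← symbR_eq_symb, symbR_add, symbR_eq_symb,
      symbR_eq_symb, ih]

/-! ## §2 `(∂^{(1)}_ν)^*∂^{(1)}_ν`: symbol `|∂^{(1)}_ν(p)|²` -/

/-- `(∂^{(1)}_ν)^*∂^{(1)}_ν` is translation invariant. [cite: BalabanImbrieJaffe1985, (7.1.6) p.322] -/
theorem isTranslInv_fdiffC_conjTranspose_mul (ν : Fin d) :
    IsTranslInv N m ((fdiffC N m ν)ᴴ * fdiffC N m ν) :=
  (isTranslInvR_iff N m _).1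
    ((((isTranslInvR_iff N m _).2 (isTranslInv_fdiffC N m ν)).conjTranspose).mul
      ((isTranslInvR_iff N m _).2 (isTranslInv_fdiffC N m ν)))

/-- **`symb ((∂^{(1)}_ν)^*∂^{(1)}_ν) q = |∂^{(1)}_ν(p)|²·1`**, `p = sOf N q` (the ν-th term of the trace in (7.1.6)), by the
symbol calculus `σ_{T^*S} = σ_T^*σ_S` and (7.1.5). [cite: BalabanImbrieJaffe1985, (7.1.6) p.322] -/
theorem symb_fdiffC_conjTranspose_mul (ν : Fin d) (q : Tor N) :
    symb N m ((fdiffC N m ν)ᴴ * fdiffC N m ν) q = ((‖dOne (sOf N q) ν‖ ^ 2 : ℝ) : ℂ) • (1 : Matrix m m ℂ) := by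
  have hT : IsTranslInvR N m m (fdiffC N m ν) := (isTranslInvR_iff N m _).2 (isTranslInv_fdiffC N m ν)
  rw [← symbR_eq_symb, symbR_mul N m m hT.conjTranspose hT, symbR_conjTranspose N m m hT, symbR_eq_symb, symb_fdiffC,
    Matrix.conjTranspose_smul, Matrix.conjTranspose_one, Matrix.smul_mul, Matrix.mul_smul, Matrix.one_mul, smul_smul,
    Complex.star_def, Complex.conj_mul', Complex.ofReal_pow]

/-! ## §3 (7.1.6): the unit-lattice Laplacian `Δ^{(1)} = Σ_ν (∂^{(1)}_ν)^*∂^{(1)}_ν` -/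

/-- `Δ^{(1)}` is translation invariant. [cite: BalabanImbrieJaffe1985, (7.1.6) p.322] -/
theorem isTranslInv_laplaceOne : IsTranslInv N m (∑ ν : Fin d, (fdiffC N m ν)ᴴ * fdiffC N m ν) :=
  isTranslInv_sum N m _ fun ν _ => isTranslInv_fdiffC_conjTranspose_mul N m ν

/-- **(7.1.6)** p. 322 [PDF 24], verbatim: *"The corresponding Laplacians are Δ(p) = Tr ∂(p)^*∂(p), Δ^{(1)}(p) =
Tr ∂^{(1)}(p)^*∂^{(1)}(p). (7.1.6)"* — PROVED for the configuration-space unit-lattice Laplacian: the symbol of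
`Σ_ν (∂^{(1)}_ν)^*∂^{(1)}_ν` at the dual momentum `q` is `Δ^{(1)}(p)·1 = (Σ_ν |e^{ip_ν} − 1|²)·1 = lapOne (sOf N q)·1` (r15's
`lapOne`, = the printed trace by `BIJ85MomentumSymbols71.trace_dMat`/`lapSym_one`). [cite: BalabanImbrieJaffe1985, (7.1.6) p.322] -/
theorem symb_laplaceOne (q : Tor N) :
    symb N m (∑ ν : Fin d, (fdiffC N m ν)ᴴ * fdiffC N m ν) q = ((lapOne (sOf N q) : ℝ) : ℂ) • (1 : Matrix m m ℂ) := by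
  rw [symb_sum, lapOne, Complex.ofReal_sum, Finset.sum_smul]
  exact Finset.sum_congr rfl fun ν _ => symb_fdiffC_conjTranspose_mul N m ν q

/-- (7.1.6) with r15's `lapOne_eq`: the symbol of `Δ^{(1)}` is `Σ_μ (2 − 2cos p_μ)·1`. [cite: BalabanImbrieJaffe1985, (7.1.6) p.322] -/
theorem symb_laplaceOne_eq_cos (q : Tor N) :
    symb N m (∑ ν : Fin d, (fdiffC N m ν)ᴴ * fdiffC N m ν) q
      = ((∑ μ : Fin d, (2 - 2 * Real.cos (sOf N q μ)) : ℝ) : ℂ) • (1 : Matrix m m ℂ) := by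
  rw [symb_laplaceOne, lapOne_eq]

/-- The momentum representation of `Δ^{(1)}`: `(F⊗1)(Δ^{(1)}f)(q, i) = Δ^{(1)}(p)·f̂_i(q)`, `p = sOf N q`.
[cite: BalabanImbrieJaffe1985, (7.1.6) p.322] -/
theorem dftC_laplaceOne_mulVec (f : Tor N × m → ℂ) (q : Tor N) (i : m) :
    (dftC N m *ᵥ ((∑ ν : Fin d, (fdiffC N m ν)ᴴ * fdiffC N m ν) *ᵥ f)) (q, i)
      = ((lapOne (sOf N q) : ℝ) : ℂ) * (dftC N m *ᵥ f) (q, i) := by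
  have hT := isTranslInv_laplaceOne N m
  have h1 : dftC N m *ᵥ ((∑ ν : Fin d, (fdiffC N m ν)ᴴ * fdiffC N m ν) *ᵥ f)
      = fibreOp N m (symb N m (∑ ν : Fin d, (fdiffC N m ν)ᴴ * fdiffC N m ν)) *ᵥ (dftC N m *ᵥ f) := by
    rw [Matrix.mulVec_mulVec, Matrix.mulVec_mulVec, ← dftC_conj_eq_fibreOp N m hT, Matrix.mul_assoc,
      Matrix.mul_assoc, star_dftC_mul, Matrix.mul_one]
  rw [h1, fibreOp_mulVec_apply, symb_laplaceOne, Matrix.smul_mulVec, Matrix.one_mulVec, Pi.smul_apply, smul_eq_mul]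

/-- `0 ≤ Δ^{(1)}` (each fibre `Δ^{(1)}(p)·1` is a nonnegative multiple of the identity; `BIJ85Eq7122Loewner.posSemidef_iff_fibrewise`).
[cite: BalabanImbrieJaffe1985, (7.1.6) p.322] -/
theorem posSemidef_laplaceOne : (∑ ν : Fin d, (fdiffC N m ν)ᴴ * fdiffC N m ν).PosSemidef := by
  rw [posSemidef_iff_fibrewise N m (isTranslInv_laplaceOne N m)]
  intro q
  rw [symb_laplaceOne, Matrix.smul_one_eq_diagonal]
  refine Matrix.PosSemidef.diagonal fun _ => ?_
  rw [Pi.zero_apply]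
  exact Complex.zero_le_real.2 (Finset.sum_nonneg fun μ _ => sq_nonneg _)

end

end Literature.MathematicalPhysics.QuantumFieldTheory.BalabanImbrieJaffe1984to88.BIJ85Eq716ConfigLaplacian
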